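import Summits.ABC.IUTFork.Cor312PilotIdelesPr
import Summits.ABC.IUTFork.Cor312StatementStability
import Summits.ABC.IUTFork.Thm311RealIsmDHMoverAssembled
import Literature.IUT.LogVolume.PacketBases
import HarnessLib

/-!
# [IUTchIII] Cor. 3.12 — the (xi-f) LICENCE at the SHARP assembled real setting, CASE B (ramified bad primes):
# a MOVER CRITERION for `q-region ⊆ Θ-hull` at a prime carrying a unique place of `F`

PROOF-ONLY file (0 definitions, 0 named `Prop` facts; abc-iut cell, WAVE-4 prover seat abc-iut-w4-d087, gen 5; own-lineage
support piece «LICENCE-AT-SHARP-RAMIFIED», part 1 of 2). TAKES NO SIDE on [IUTchIII] Cor. 3.12.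

CONTEXT (E3 RESULT, abc-iut-C-cert-2 `Cor312NotLicenceRealSharp` p433074/p433664, abc-iut-w5-d107 `Cor312NotLicencePrVolSharp`
p433872): at abc-iut-c312-7's genuine print-normalised sharp setting `Real.settingPrVolSharp` with realising pilot ideles,
a bad place over an ODD prime UNRAMIFIED in `F` refutes the typed (xi-f) licence `Thm311ToCor312.Licence` (hence the
branch-C S_H antecedent `QPinned ∧ PilotKummerCompatHull`) — CASE A. CASE B (every bad place over `2` or over a prime
RAMIFIED in `F`) was left OPEN: there Dupuy–Hilado's typed (Ind2) = `Real.ismDH` (bicontinuous `ℚ`-linear lattice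
automorphisms of the log-shell, §4.9) MOVES `𝒪_L`-boxes (this seat's gen-4 `Cor312PinnedThetaRealSharpNegative`,
abc-iut-c312-5 `Cor312Ind2BallsRamified`, abc-iut-w5-d180 `Thm311RealIsmDHOrbitSpan`).

THIS FILE isolates the mechanism by which (Ind2) can make the licence HOLD at a ramified bad prime. At a prime `p₀`
carrying a UNIQUE place `x₀` of `F` the `(j+1)`-packet over `p₀` has ONE real summand `X_{(x₀,…,x₀)} = K_{x₀}^{⊗(j+1)}`;
the sharp Θ-box there is `ι_j(t_{Θ,j,x₀})·(R_I)^∼` and the `q`-region is `ι_j(t_{q,x₀})·(R_I)^∼` (abc-iut-c312-3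
`sharpBoxDH`/`qCentreDH`, Dupuy–Hilado §3.7/§3.9). If (Ind2)-elements `g_0,…,g_j ∈ Real.ismDH` and a pure tensor
`w_0 ⊗ ⋯ ⊗ w_j` of the Θ-box (`Π_a ‖w_a‖ ≤ ‖t_{Θ,j,x₀}‖`) satisfy `Π_a ‖g_a(w_a)‖ ≥ ‖t_{q,x₀}‖`, then the (Ind2)-family
`Φ = ⊗_a g_a` (at `x₀`; identity elsewhere) carries that pure tensor to a point of the union of the possible images
whose EVERY field-factor coordinate has norm `≥ ‖t_{q,x₀}‖`; every hull-set `λ·𝒪_L` containing the union therefore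
contains the `q`-region, i.e. **`qRegion j p₀ ⊆ thetaHull j p₀`** (`qRegion_subset_thetaHull_settingPrVolSharp_of_movers`).
Also recorded: the elementary inclusion `q-region ⊆ Θ-region` wherever `‖t_{q,x}‖ ≤ ‖t_{Θ,j,x}‖` at every `x | p`
(all good primes, the label `0`), and at `∞` (trivial archimedean container).

§0 generic lemmas: `Cor312.HullFrame.subset_hull_of_forall` (a set contained in every hull-set containing `U` lies in
`hull U`), `norm_dEquiv_purePacket` (`‖ψ(⊗_a w_a)_i‖ = Π_a ‖w_a‖`), `purePacket_mem_iota_smul_normalizedPacket`.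
Part 2 (`Cor312LicenceRealSharpTame`) supplies the movers at TAME places from abc-iut-w5-d180's transitivity of
`Real.ismDH` on primitive lattice vectors and concludes `Licence`, the S_H antecedent and the typed `Statement` at
`settingPrVolSharp` for shallow honestly-scaled ideles. HONEST SCOPE: OUR typed objects (c312-5's `logShellsDH` with
DH's (Ind2) as ALL shell-preserving lattice automorphisms; the SHARP (Ind3) reading; the trivial archimedean container);
nothing here asserts or denies [IUTchIII] Cor. 3.12 for initial Θ-data. [claim: Mochizuki2012, status: disputed] for
every [IUTchIII] locution; [cite: DupuyHilado2025, §3.7, §3.9, §4.9]; [cite: ScholzeStix2018, §2.2 pp. 9–10].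
Consumed BY NAME, nothing restated. typed ≠ proved; instantiated ≠ endorsed.
-/

noncomputable section

open Metric Set Function NumberField IsDedekindDomain
open scoped Pointwise

namespace Summit.ABC.IUTFork

/-! ## §0. Generic lemmas -/

namespace Cor312.HullFrame

/-- A set contained in every hull-set that contains `U` is contained in the holomorphic hull of `U` (both branches
of the definition: the intersection of those hull-sets, resp. everything). [folklore] -/
theorem subset_hull_of_forall {X : Type} (F : HullFrame X) {U V : Set X}
    (h : ∀ H ∈ F.Hul, U ⊆ H → V ⊆ H) : V ⊆ F.hull U := by
  unfold hull
  split_ifs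
  · exact Set.subset_sInter fun H hH => h H hH.1 hH.2
  · exact Set.subset_univ _

end Cor312.HullFrame

namespace Thm311.Real

open Cor312 Cor312Vol Literature.IUT.LogThetaLattice Literature.IUT.LogVolume
  Literature.NumberTheory.NumberFields Literature.NumberTheory.GaloisRepresentations.Ultrametric

namespace LicenceMover

section Packet

variable (p : ℕ) [Fact p.Prime] {I : Type} [Fintype I] [DecidableEq I]
  (k : I → Type) [∀ i, NontriviallyNormedField (k i)] [∀ i, NormedAlgebra ℚ_[p] (k i)]
  [∀ i, IsUltrametricDist (k i)] [∀ i, ProperSpace (k i)]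

omit [∀ i, IsUltrametricDist (k i)] in
/-- **The field-factor coordinates of a pure tensor have norm the product of the norms**:
`‖ψ(w_0 ⊗ ⋯ ⊗ w_j)_i‖ = Π_a ‖w_a‖` (`ψ` is an algebra isomorphism onto a product of fields and the factor embeddings are
isometric into every factor, abc-iut-c312-3 `norm_dEquiv_iota`). [cite: Mochizuki2012, IUTchIV Prop. 1.4 (i) p. 13] -/
theorem norm_dEquiv_purePacket (x : Π i, k i) (j : DIdx p k) :
    ‖dEquiv p k (purePacket p k x) j‖ = ∏ i, ‖x i‖ := by
  rw [purePacket_eq_prod_iota, map_prod, Finset.prod_apply, norm_prod]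
  exact Finset.prod_congr rfl fun i _ => norm_dEquiv_iota p k i (x i) j

/-- **A pure tensor `⊗_a w_a` with `Π_a ‖w_a‖ ≤ ‖c‖` lies in the translated normalized packet `ι_i(c)·(R_I)^∼`**
(`c ≠ 0`; `ι_i(c)⁻¹·⊗_a w_a` has every field-factor coordinate of norm `≤ 1`). [cite: Mochizuki2012, IUTchIV Prop. 1.4 (i) p. 13] -/
theorem purePacket_mem_iota_smul_normalizedPacket [Nonempty I] (i : I) {c : k i} (hc : c ≠ 0)
    (x : Π a, k a) (h : ∏ a, ‖x a‖ ≤ ‖c‖) :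
    purePacket p k x ∈ iota p k i c • (normalizedPacket p k : Set (PacketAlgebra p k)) := by
  refine Set.mem_smul_set.mpr ⟨iota p k i c⁻¹ * purePacket p k x, ?_, ?_⟩
  · refine (IsmDHMover.mem_normalizedPacket_iff_norm_dEquiv_le p k _).mpr fun j => ?_
    rw [map_mul, Pi.mul_apply, norm_mul, norm_dEquiv_iota, norm_dEquiv_purePacket, norm_inv,
      inv_mul_le_iff₀ (norm_pos_iff.mpr hc), mul_one]
    exact h
  · rw [smul_eq_mul, ← mul_assoc, ← map_mul, mul_inv_cancel₀ hc, map_one, one_mul]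

end Packet

end LicenceMover

/-! ## §1. `q-region ⊆ Θ-region` wherever `‖t_q‖ ≤ ‖t_Θ‖`; the archimedean packets -/

section Assembled

variable {F : Type} [Field F] [NumberField F] (X : PilotData F) {logv : PadicLogs F} (hlog : LogvAnalytic logv)
  (M : Type) [Field M] [NumberField M]
  (archPk : ∀ (j : (thetaIndex X).Label) (vQ : (thetaIndex X).VQ), Set ((logShellsDH X logv).Packet j vQ))
  (archSub : ∀ (j : (thetaIndex X).Label) (v : (thetaIndex X).V),
    Set ((logShellsDH X logv).Packet j ((thetaIndex X).over v)))
  (Ψ : ℤ → ∀ v : (thetaIndex X).V, v ∈ (thetaIndex X).Vbad → Set ((logShellsDH X logv).StarPacket v))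
  (act : ℤ → ∀ v : (thetaIndex X).V, v ∈ (thetaIndex X).Vbad →
    (logShellsDH X logv).StarPacket v → Module.End ℚ ((logShellsDH X logv).StarPacket v))
  (Mmod : ℤ → ∀ j : (thetaIndex X).LabelStar, Set ((logShellsDH X logv).GlobalPacket j.1))
  (region : ℤ → ∀ j : (thetaIndex X).LabelStar, FinDivisor M → ∀ vQ : (thetaIndex X).VQ,
    Set ((logShellsDH X logv).Packet j.1 vQ))
  (n : ℤ) {HT : Type} {LogLink : HT → HT → Type} {IsFull : ∀ {s t : HT}, LogLink s t → Prop}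
  (lat : LGPGaussianLogThetaLattice LogLink IsFull)
  {Frd : Type} {IsoF : Frd → Frd → Type} {Ob : Frd → Type} {realify : Frd → Frd} {Strip : Type}
  {IsoS : Strip → Strip → Type} {Mv : ∀ v : (thetaIndex X).V, v ∈ (thetaIndex X).Vbad → Type}
  [∀ v h, Monoid (Mv v h)]
  (sig : GlobalLGPFrobenioidSignature (thetaIndex X).lstar (thetaIndex X).V (· ∈ (thetaIndex X).Vbad)
    Frd IsoF Ob realify Strip IsoS Mv)
  (split : SplittingMonoids Mv) {ObΔ : Type} {N : ∀ v : (thetaIndex X).V, v ∈ (thetaIndex X).Vbad → Type}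
  [∀ v h, Monoid (N v h)] (qData : QPilotData ObΔ N)
  (tq : ∀ (pp : Nat.Primes) (x : (thetaIndex X).Fibre (.inr pp)),
    haveI : Fact (pp : ℕ).Prime := ⟨pp.2⟩; kOf X pp.1 x)
  (t : ∀ (pp : Nat.Primes) (_ : Fin X.lstar) (x : (thetaIndex X).Fibre (.inr pp)),
    haveI : Fact (pp : ℕ).Prime := ⟨pp.2⟩; kOf X pp.1 x)
  (htq0 : ∀ pp x, tq pp x ≠ 0)
  (htq1 : ∀ (pp : Nat.Primes) (x : (thetaIndex X).Fibre (.inr pp)),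
    haveI : Fact (pp : ℕ).Prime := ⟨pp.2⟩; placeOf X pp.1 x ∉ X.S → ‖tq pp x‖ = 1)

/-- At the archimedean place the `q`-region lies in EVERY Kummer image of the Θ-pilot object (the parent files' trivial
archimedean container: the Θ-box there is everything). [folklore] -/
theorem qRegion_subset_thetaRegion_settingPrVolSharp_inl (m : ℤ) (j : (thetaIndex X).Label) (u : Unit) :
    (settingPrVolSharp X hlog M archPk archSub Ψ act Mmod region n lat sig split qData tq t htq0 htq1).qRegion j
        (.inl u) ⊆
      (settingPrVolSharp X hlog M archPk archSub Ψ act Mmod region n lat sig split qData tq t htq0 htq1).thetaRegion m j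
        (.inl u) := by
  intro x _
  show factorMapDH X hlog j (.inl u) x ∈ thetaBoxDH X hlog (sharpBoxDH X hlog t) j (.inl u)
  exact Set.mem_univ _

/-- **`q`-region ⊆ Θ-region at a prime where the `q`-idele is no deeper than the label idele**: if
`‖t_{q,x}‖ ≤ ‖t_{Θ,j,x}‖` (the label idele: `t_{Θ,j,x}` for `j ≥ 1`, `1` at the label `0`) at every place `x | p`, then
`𝒪_𝕃(−P_q)_{p,j} ⊆ 𝒪_𝕃(−P_Θ)_{p,j}` — both are preimages of polydiscs of the field-factor product with radii read at the
last coordinate of each summand (abc-iut-c312-3 `boxOf_smul_normalizedPacket`, `norm_dEquiv_iota`). In particular at a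
prime under NO bad place (both ideles units) and at the label `0` (when `‖t_q‖ ≤ 1`). [cite: DupuyHilado2025, §3.7, §3.9] -/
theorem qRegion_subset_thetaRegion_settingPrVolSharp_inr (ht0 : ∀ pp i x, t pp i x ≠ 0) (m : ℤ)
    (j : (thetaIndex X).Label) (pp : Nat.Primes)
    (hle : ∀ x : (thetaIndex X).Fibre (.inr pp),
      haveI : Fact (pp : ℕ).Prime := ⟨pp.2⟩; ‖tq pp x‖ ≤ ‖labelIdele X t pp j x‖) :
    (settingPrVolSharp X hlog M archPk archSub Ψ act Mmod region n lat sig split qData tq t htq0 htq1).qRegion j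
        (.inr pp) ⊆
      (settingPrVolSharp X hlog M archPk archSub Ψ act Mmod region n lat sig split qData tq t htq0 htq1).thetaRegion m j
        (.inr pp) := by
  haveI hpF : Fact (pp : ℕ).Prime := ⟨pp.2⟩
  haveI : Nonempty ((thetaIndex X).Caps j) := ⟨0⟩
  set P := presAt X hlog pp with hP
  have hg : ∀ (e : (thetaIndex X).Caps j → (thetaIndex X).Fibre (.inr pp)) (i : DIdx pp.1 (P.kk e)),
      dEquiv pp.1 (P.kk e) (iota pp.1 (P.kk e) (Fin.last _) (labelIdele X t pp j (e (Fin.last _)))) i ≠ 0 :=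
    fun e i => dEquiv_iota_ne_zero pp.1 _ (Fin.last _) (labelIdele_ne_zero X t ht0 pp j _) i
  have hbox : P.boxOf (sharpBoxDH X hlog t pp j) =
      hullSet (P.factorField j) (P.centreOf fun e =>
        iota pp.1 (P.kk e) (Fin.last _) (labelIdele X t pp j (e (Fin.last _)))) :=
    P.boxOf_smul_normalizedPacket _ hg
  intro x hx
  change P.factorMap j x ∈ hullSet (P.factorField j) (qCentreDH X hlog tq j (.inr pp)) at hx
  change P.factorMap j x ∈ P.boxOf (sharpBoxDH X hlog t pp j)
  rw [hbox]
  rw [hullSet, mem_polydisc] at hx ⊢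
  rintro ⟨e, i⟩
  calc ‖P.factorMap j x ⟨e, i⟩‖ ≤ ‖qCentreDH X hlog tq j (.inr pp) ⟨e, i⟩‖ := hx ⟨e, i⟩
    _ = ‖tq pp (e (Fin.last _))‖ := norm_dEquiv_iota pp.1 (P.kk e) (Fin.last _) _ i
    _ ≤ ‖labelIdele X t pp j (e (Fin.last _))‖ := hle _
    _ = ‖P.centreOf (fun e => iota pp.1 (P.kk e) (Fin.last _) (labelIdele X t pp j (e (Fin.last _)))) ⟨e, i⟩‖ :=
        (norm_dEquiv_iota pp.1 (P.kk e) (Fin.last _) _ i).symm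

/-- Every Kummer image of the Θ-pilot object lies in the Θ-hull `^{n,∘}𝒰_{j,v_ℚ}` (identity indeterminacy; the hull
contains the union of the possible images). [folklore] -/
theorem thetaRegion_subset_thetaHull_settingPrVolSharp (m : ℤ) (j : (thetaIndex X).Label) (vQ : (thetaIndex X).VQ) :
    (settingPrVolSharp X hlog M archPk archSub Ψ act Mmod region n lat sig split qData tq t htq0 htq1).thetaRegion m j
        vQ ⊆
      (settingPrVolSharp X hlog M archPk archSub Ψ act Mmod region n lat sig split qData tq t htq0 htq1).thetaHull j vQ :=
  fun _ hx => ((settingPrVolSharp X hlog M archPk archSub Ψ act Mmod region n lat sig split qData tq t htq0 htq1).frame j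
      vQ).subset_hull _
    ((settingPrVolSharp X hlog M archPk archSub Ψ act Mmod region n lat sig split qData tq t htq0
        htq1).thetaRegion3_subset_sUnion j vQ (Set.mem_iUnion.mpr ⟨m, hx⟩))

/-! ## §2. The mover criterion at a prime carrying a unique place of `F` -/

/-- **MOVER CRITERION for `q-region ⊆ Θ-hull` at a prime `p₀` carrying a UNIQUE place `x₀` of `F`.** Let `j` be a label,
`g_0, …, g_j ∈ Real.ismDH` (Dupuy–Hilado's typed (Ind2) at `x₀`, §4.9) and let `w_a ∈ K_x` (`a ∈ S^±_{j+1}`, `x | p₀`) be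
coordinates with `Π_a ‖w_a(x₀)‖ ≤ ‖t_{Θ,j,x₀}‖` (so the pure tensor `⊗_a w_a` lies in the sharp Θ-box
`ι_j(t_{Θ,j,x₀})·(R_I)^∼`, the ONLY summand being the constant tuple `(x₀,…,x₀)`) and
`‖t_{q,x₀}‖ ≤ Π_a ‖g_a(w_a(x₀))‖`. Then the (Ind2)-family `⊗_a g_a` (at `x₀`; identity at every other place) carries
`⊗_a w_a` to a point of `⋃ (possible images)` all of whose field-factor coordinates have norm `Π_a ‖g_a(w_a(x₀))‖`
(`norm_dEquiv_purePacket`); every hull-set `λ·𝒪_L` containing the union has `‖λ_i‖ ≥ ‖t_{q,x₀}‖` at every factor, hence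
contains the `q`-region `ι_j(t_{q,x₀})·(R_I)^∼`: **`qRegion j p₀ ⊆ thetaHull j p₀`** at abc-iut-c312-7's
`Real.settingPrVolSharp` (any columns/context binders). [cite: DupuyHilado2025, §3.9, §4.9] [claim: Mochizuki2012, status: disputed] -/
theorem qRegion_subset_thetaHull_settingPrVolSharp_of_movers (ht0 : ∀ pp i x, t pp i x ≠ 0)
    (pp : Nat.Primes) (v₀ : HeightOneSpectrum (𝓞 F)) (hv₀ : (thetaIndex X).over (.inr v₀) = .inr pp)
    (huniq : ∀ x : (thetaIndex X).Fibre (.inr pp), x = ⟨.inr v₀, hv₀⟩) (j : (thetaIndex X).Label)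
    (g : ℕ → (Carrier (.inr v₀ : Place F) ≃ₗ[ℚ] Carrier (.inr v₀ : Place F)))
    (hg : ∀ a, g a ∈ ismDH logv (.inr v₀ : Place F))
    (w : (thetaIndex X).Caps j → ∀ x : (thetaIndex X).Fibre (.inr pp), haveI : Fact (pp : ℕ).Prime := ⟨pp.2⟩; kOf X pp.1 x)
    (hw : haveI : Fact (pp : ℕ).Prime := ⟨pp.2⟩;
      ∏ a, ‖w a ⟨.inr v₀, hv₀⟩‖ ≤ ‖labelIdele X t pp j ⟨.inr v₀, hv₀⟩‖)
    (hbig : haveI : Fact (pp : ℕ).Prime := ⟨pp.2⟩;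
      ‖tq pp ⟨.inr v₀, hv₀⟩‖ ≤
        ∏ a : (thetaIndex X).Caps j, ‖toR pp.1 v₀ (natCast_mem_placeOf X pp.1 ⟨.inr v₀, hv₀⟩)
          (g a.val (ofR pp.1 v₀ (natCast_mem_placeOf X pp.1 ⟨.inr v₀, hv₀⟩) (w a ⟨.inr v₀, hv₀⟩)))‖) :
    (settingPrVolSharp X hlog M archPk archSub Ψ act Mmod region n lat sig split qData tq t htq0 htq1).qRegion j
        (.inr pp) ⊆
      (settingPrVolSharp X hlog M archPk archSub Ψ act Mmod region n lat sig split qData tq t htq0 htq1).thetaHull j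
        (.inr pp) := by
  classical
  haveI hpF : Fact (pp : ℕ).Prime := ⟨pp.2⟩
  haveI : Nonempty ((thetaIndex X).Caps j) := ⟨0⟩
  set x₀ : (thetaIndex X).Fibre (.inr pp) := ⟨.inr v₀, hv₀⟩ with hx₀
  have hv : ((pp : ℕ) : 𝓞 F) ∈ v₀.asIdeal := natCast_mem_placeOf X pp.1 x₀
  let L := logShellsDH X logv
  set P := presAt X hlog pp with hP
  set PS := settingPrVolSharp X hlog M archPk archSub Ψ act Mmod region n lat sig split qData tq t htq0 htq1 with hPS
  -- every tuple of places over `p₀` is the constant tuple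
  have hev : ∀ ev : (thetaIndex X).Caps j → (thetaIndex X).Fibre (.inr pp), ev = fun _ => x₀ :=
    fun ev => funext fun a => huniq (ev a)
  -- (1) the (Ind2)-family: `g_a` at `v₀` on the `a`-th tensor factor, the identity elsewhere
  let gPl : ℕ → ∀ y : Place F, Carrier y ≃ₗ[ℚ] Carrier y := fun a y =>
    if h : y = .inr v₀ then (by subst h; exact g a) else LinearEquiv.refl ℚ (Carrier y)
  have hgPl_v₀ : ∀ a, gPl a (.inr v₀) = g a := fun a => by
    show (if h : (Sum.inr v₀ : Place F) = .inr v₀ then _ else _) = g a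
    rw [dif_pos rfl]
  have hgPl_mem : ∀ a (y : Place F), gPl a y ∈ ismDH logv y := by
    intro a y
    by_cases hy : y = .inr v₀
    · subst hy; rw [hgPl_v₀]; exact hg a
    · show (if h : y = .inr v₀ then _ else _) ∈ _
      rw [dif_neg hy]; exact refl_mem_ismDH _ y
  let Φ : L.PacketAut := fun j' vQ' => L.factorwise j' vQ' fun a => L.summandwise vQ' fun v => gPl a.val v.1
  have hΦ : Φ ∈ L.Ind2Family := fun j' vQ' => ⟨fun a v => gPl a.val v.1, fun a v => hgPl_mem a.val v.1, rfl⟩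
  -- (2) the pure tensor `⊗_a w_a` lies in the Kummer image of index `0`
  let y : (thetaIndex X).Caps j → L.Packet1 (.inr pp) := fun a v => (P.φ v).symm (w a v)
  let xw : L.Packet j (.inr pp) := L.tprod j (.inr pp) y
  have hR : PS.thetaRegion 0 j (.inr pp) =
      P.comparison j ⁻¹' Set.pi univ fun ev =>
        iota pp.1 (P.kk ev) (Fin.last _) (labelIdele X t pp j (ev (Fin.last _))) •
          (normalizedPacket pp.1 (P.kk ev) : Set (P.X ev)) := by
    change (fun x => P.factorMap j x) ⁻¹' P.boxOf (sharpBoxDH X hlog t pp j) = _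
    rw [P.factorMap_preimage_boxOf]
    rfl
  have hxw : xw ∈ PS.thetaRegion 0 j (.inr pp) := by
    rw [hR]
    show P.comparison j xw ∈ Set.pi univ _
    rw [Set.mem_univ_pi]
    intro ev
    obtain rfl : ev = fun _ => x₀ := hev ev
    rw [show P.comparison j xw (fun _ => x₀) = _ from P.comparison_tprod j y (fun _ => x₀)]
    have hsimp : (fun a => P.φ x₀ (y a x₀)) = fun a => w a x₀ :=
      funext fun a => LinearEquiv.apply_symm_apply _ _
    rw [hsimp]
    exact LicenceMover.purePacket_mem_iota_smul_normalizedPacket pp.1 (P.kk fun _ => x₀) (Fin.last _)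
      (labelIdele_ne_zero X t ht0 pp j x₀) (fun a => w a x₀) hw
  -- (3) its image under `Φ` lies in the union of the possible images
  have hΦxw : Φ j (.inr pp) xw = L.tprod j (.inr pp) fun a v => gPl a.val v.1 (y a v) :=
    L.factorwise_summandwise_tprod j (.inr pp) (fun a v => gPl a.val v.1) y
  have hU : Φ j (.inr pp) xw ∈ ⋃₀ PS.possibleImages j (.inr pp) :=
    Set.mem_sUnion.mpr ⟨Φ j (.inr pp) '' PS.thetaRegion3 j (.inr pp),
      ⟨Φ, Subgroup.subset_closure (Set.mem_union_right _ hΦ), rfl⟩,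
      ⟨xw, Set.mem_iUnion.mpr ⟨0, hxw⟩, rfl⟩⟩
  -- (4) the field-factor coordinates of the image at the constant tuple
  have hnorm : ∀ idx : DIdx pp.1 (P.kk fun _ => x₀),
      ‖tq pp x₀‖ ≤ ‖dEquiv pp.1 (P.kk fun _ => x₀) (P.comparison j (Φ j (.inr pp) xw) fun _ => x₀) idx‖ := by
    intro idx
    rw [hΦxw, show P.comparison j (L.tprod j (.inr pp) fun a v => gPl a.val v.1 (y a v)) (fun _ => x₀) = _ from
      P.comparison_tprod j (fun a v => gPl a.val v.1 (y a v)) (fun _ => x₀)]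
    have hval : (fun a => P.φ x₀ (gPl a.val x₀.1 (y a x₀))) =
        fun a => toR pp.1 v₀ hv (g a.val (ofR pp.1 v₀ hv (w a x₀))) := by
      funext a
      rw [hgPl_v₀]
      rfl
    rw [hval]
    show ‖tq pp x₀‖ ≤ ‖dEquiv pp.1 (P.kk fun _ => x₀) (purePacket pp.1 (P.kk fun _ => x₀) _) idx‖
    rw [LicenceMover.norm_dEquiv_purePacket]
    exact hbig
  -- (5) every hull-set containing the union contains the `q`-region
  refine Cor312.HullFrame.subset_hull_of_forall (PS.frame j (.inr pp)) fun H hH hUH => ?_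
  obtain ⟨H', hH', rfl⟩ := hH
  obtain ⟨c, -, rfl⟩ := hH'
  have hin := hUH hU
  intro z hz
  change P.factorMap j z ∈ hullSet (P.factorField j) (qCentreDH X hlog tq j (.inr pp)) at hz
  change P.factorMap j (Φ j (.inr pp) xw) ∈ hullSet (P.factorField j) c at hin
  change P.factorMap j z ∈ hullSet (P.factorField j) c
  rw [hullSet, mem_polydisc] at hz hin ⊢
  rintro ⟨ev, idx⟩
  obtain rfl : ev = fun _ => x₀ := hev ev
  calc ‖P.factorMap j z ⟨_, idx⟩‖ ≤ ‖qCentreDH X hlog tq j (.inr pp) ⟨_, idx⟩‖ := hz _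
    _ = ‖tq pp x₀‖ := norm_dEquiv_iota pp.1 (P.kk fun _ => x₀) (Fin.last _) _ idx
    _ ≤ ‖dEquiv pp.1 (P.kk fun _ => x₀) (P.comparison j (Φ j (.inr pp) xw) fun _ => x₀) idx‖ := hnorm idx
    _ = ‖P.factorMap j (Φ j (.inr pp) xw) ⟨_, idx⟩‖ := rfl
    _ ≤ ‖c ⟨_, idx⟩‖ := hin _

end Assembled

end Thm311.Real

end Summit.ABC.IUTFork

end
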